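import Literature.NumberTheory.EllipticCurves.KleinJCuspExpansion
import Literature.NumberTheory.EllipticCurves.HeegnerPointsClassGroupInjProofs
import Literature.NumberTheory.EllipticCurves.HeegnerPointsImaginaryQuadraticProofs
import Literature.NumberTheory.EllipticCurves.ComplexMultiplicationHasCMTwoLeavesProofs
import Mathlib.NumberTheory.NumberField.ClassNumber
import HarnessLib

/-!
# Granville–Stark, Theorem 1 — the singular modulus `j(τ_d)`: size, degree, and the final asymptotics

Topic `NumberTheory/DiophantineGeometry` (family `abc`, record `abc.S22`).  Second of three
proofs-only files (theorems only: no definitions, no named facts) towards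
`Literature.NumberTheory.DiophantineGeometry.granville_stark_of_cmInput`
(`AbcWave0GranvilleStarkTheorem1Proofs.lean`), the deduction of A. Granville, H. M. Stark, Invent. Math.
139 (2000), Theorem 1 (uniform `abc` ⟹ `h(−d) ≥ (π/3 + o(1)) √d/log d`).  With the tree's complex
multiplication library (`Literature/NumberTheory/EllipticCurves`, `…/QuadraticFields`) — Klein's
`j` (`kleinJ`), the singular modulus `formJ Q = j(τ_Q)` of a form `Q`, the principal form
`principalForm D` (so `τ = (−1+√−d)/2` or `√−d/2`, exactly Granville–Stark's `τ`, p. 4), the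
reduced forms `reducedForms D` and their number `classNumber D = h(D)` — this file proves:

* `norm_qParam_heegnerTau_principalForm` : `|q| = e^{−π√d}` at `τ_d` ("since `|1/q| = e^{π√d/a}`",
  p. 5, with `a = 1`), and `exp_sub_le_norm_formJ_principalForm` : for `d ≥ 16`,
  `e^{π√d} − 784 ≤ |j(τ_d)|` and `e^{π√d} ≥ 10⁴`, from the tree's explicit
  `j = 1/q + 744 + O(q)` (`norm_E₄_cube_div_discriminant_sub_sub_le`, error `4·10⁵|q|` for
  `|q| ≤ 10⁻⁴`) — Granville–Stark's "`max{|j(τ*)|, 1} ≍ e^{π√d/a}`" for the principal class;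
* `card_reducedForms_discr_le_classNumber` : **`h(d_K) ≤ h_K`** for an imaginary quadratic field
  `K` — the form-to-ideal map `(A, B, C) ↦ [ℤA + ℤ(−B+√d_K)/2]` is injective on reduced forms
  (the tree's `isGamma0Equiv_of_span_mul_formIdeal_eq`, Cox Thm. 7.7(ii), and "`j` separates reduced
  forms", `inStrictFd_heegnerTau`), so the number of reduced forms of discriminant `d_K` is at
  most Mathlib's `NumberField.classNumber K` (the easy half of `h(d_K) = h_K`; only this half is
  needed, to pass from the degree bound `deg j(τ_d) ≤ h(d_K)` of Cox Thm. 10.23 — the tree's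
  `natDegree_minpoly_formJ_le_classNumber` — to the class number of the field);
* `granvilleStark_asymptotics` : the closing real-variable step — if `κ (π/3 − δ) < π` then for
  `d ≥ d₀(κ, A, L, δ)` every `h > 0` with `π√d − L ≤ h (κ log d + A)` satisfies
  `(π/3 − δ) √d / log d ≤ h` ("Comparing this with (6) implies Theorem 1", p. 5).

## References

* A. Granville, H. M. Stark, *ABC implies no "Siegel zeros" for `L`-functions of characters with
  negative discriminant*, Invent. Math. 139 (2000) 509–523, §2 (p. 4: `τ`, integrality and
  conjugates of `j(τ)`; p. 5: proof of Theorem 1, (6)–(7)). [GranvilleStark2000]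
* D. A. Cox, *Primes of the form x² + ny²*, 2nd ed., Wiley 2013, Thm. 7.7(ii), Thm. 10.23, §11.A
  (`j = 1/q + 744 + …`). [Cox2013]
-/

noncomputable section

open Complex UpperHalfPlane NumberField
open scoped Real

open Literature.NumberTheory.EllipticCurves Literature.NumberTheory.QuadraticFields.BinaryQuadraticForm
  Literature.NumberTheory.QuadraticFields.Quadratic Literature.NumberTheory.EllipticCurves.ModularForms

namespace Literature.NumberTheory.DiophantineGeometry

/-! ### The nome at the CM point of the principal form -/

/-- `Im τ_d = √|D|/2` for the Heegner point `τ_d = (−b + √D)/2` of the principal form `(1, b, c)` of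
discriminant `D < 0` (Granville–Stark's `τ = (−1+√−d)/2` or `√−d/2`, p. 4). [folklore] -/
theorem im_heegnerTau_principalForm {D : ℤ} (hD : D < 0) (h4 : D % 4 = 0 ∨ D % 4 = 1) :
    (heegnerTau (principalForm D)).im = √(-(D : ℝ)) / 2 := by
  set Q := principalForm D with hQ
  have h1 : Q.1 = 1 := principalForm_fst D
  have hdisc : Q.2.1 ^ 2 - 4 * Q.1 * Q.2.2 = D := discr_principalForm h4
  have hneg : Q.2.1 ^ 2 - 4 * Q.1 * Q.2.2 < 0 := by rw [hdisc]; exact hD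
  have hpos : 0 < Q.1 := by rw [h1]; exact one_pos
  have hcoe := coe_heegnerTau hpos hneg
  have him : (heegnerTau Q).im = √(4 * Q.1 * Q.2.2 - Q.2.1 ^ 2 : ℝ) / (2 * Q.1) := by
    rw [← UpperHalfPlane.coe_im, hcoe]
  rw [him, h1]
  have hcast : (4 * ((1 : ℤ) : ℝ) * (Q.2.2 : ℝ) - (Q.2.1 : ℝ) ^ 2) = -(D : ℝ) := by
    have := congrArg (fun z : ℤ => (z : ℝ)) hdisc
    push_cast at this ⊢
    rw [h1] at this
    simp only [Int.cast_one] at this ⊢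
    linarith
  rw [hcast]
  push_cast
  ring

/-- **`|q| = e^{−π√d}` at `τ_d`**: the nome `q = e^{2πiτ}` at the CM point of the principal form of
discriminant `D = −d < 0` has absolute value `e^{−π√d}` (Granville–Stark, p. 5: "`|1/q| = e^{π√d/a}`",
`a = 1`). [cite: GranvilleStark2000, §2 proof of Theorem 1] -/
theorem norm_qParam_heegnerTau_principalForm {D : ℤ} (hD : D < 0) (h4 : D % 4 = 0 ∨ D % 4 = 1) :
    ‖Function.Periodic.qParam 1 (heegnerTau (principalForm D) : ℂ)‖ = Real.exp (-(π * √(-(D : ℝ)))) := by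
  rw [qParam_one_eq_cexp, Complex.norm_exp]
  congr 1
  have him := im_heegnerTau_principalForm hD h4
  rw [← UpperHalfPlane.coe_im] at him
  simp only [Complex.mul_re, Complex.re_ofNat, Complex.ofReal_re, Complex.im_ofNat,
    Complex.ofReal_im, mul_zero, sub_zero, Complex.I_re, Complex.I_im, Complex.mul_im, zero_mul,
    add_zero, mul_one, him]
  ring

/-- `10⁴ ≤ e¹²` (from `e > 2.7182818283`). [folklore] -/
theorem ten_pow_four_le_exp_twelve : (10 ^ 4 : ℝ) ≤ Real.exp 12 := by
  have h1 : (2.7182818283 : ℝ) < Real.exp 1 := Real.exp_one_gt_d9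
  have h2 : Real.exp 12 = Real.exp 1 ^ 12 := by rw [← Real.exp_nat_mul]; norm_num
  rw [h2]
  have h3 : (10 ^ 4 : ℝ) ≤ (2.7182818283 : ℝ) ^ 12 := by norm_num
  exact h3.trans (pow_le_pow_left₀ (by norm_num) h1.le 12)

/-- **The singular modulus of the principal class is huge**: for a discriminant `D ≤ −16`,
`e^{π√|D|} − 784 ≤ |j(τ_D)|` and `e^{π√|D|} ≥ 10⁴`, where `j(τ_D) = formJ (principalForm D)`; from
`j = 1/q + 744 + O(q)` with the tree's explicit error `|j − 1/q − 744| ≤ 4·10⁵|q|` for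
`|q| ≤ 10⁻⁴` and `|1/q| = e^{π√|D|}`.  Granville–Stark, p. 5: "we deduce from the `q`-expansion for
`j(τ*)` in (4) that `max{|j(τ*)|, 1} ≍ e^{π√d/a}`" (here the principal form, `a = 1`).
[cite: GranvilleStark2000, §2 proof of Theorem 1] -/
theorem exp_sub_le_norm_formJ_principalForm {D : ℤ} (hD : D ≤ -16) (h4 : D % 4 = 0 ∨ D % 4 = 1) :
    Real.exp (π * √(-(D : ℝ))) - 784 ≤ ‖formJ (principalForm D)‖ ∧
      10 ^ 4 ≤ Real.exp (π * √(-(D : ℝ))) := by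
  have hD0 : D < 0 := by omega
  set τ := heegnerTau (principalForm D) with hτ
  set q := Function.Periodic.qParam 1 (τ : ℂ) with hq
  set X := Real.exp (π * √(-(D : ℝ))) with hX
  have hnq : ‖q‖ = X⁻¹ := by
    rw [hq, hτ, norm_qParam_heegnerTau_principalForm hD0 h4, Real.exp_neg]
  -- `π √|D| ≥ 12`
  have hsqrt : (4 : ℝ) ≤ √(-(D : ℝ)) := by
    rw [show (4 : ℝ) = √16 by rw [show (16 : ℝ) = 4 ^ 2 by norm_num, Real.sqrt_sq (by norm_num)]]
    exact Real.sqrt_le_sqrt (by exact_mod_cast (by omega : (16 : ℤ) ≤ -D))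
  have h12 : (12 : ℝ) ≤ π * √(-(D : ℝ)) := by nlinarith [Real.pi_gt_three, hsqrt]
  have hX4 : (10 ^ 4 : ℝ) ≤ X := ten_pow_four_le_exp_twelve.trans (Real.exp_le_exp.mpr h12)
  have hXpos : 0 < X := Real.exp_pos _
  refine ⟨?_, hX4⟩
  have hq4 : ‖q‖ ≤ 1 / 10 ^ 4 := by
    rw [hnq, inv_le_comm₀ hXpos (by norm_num)]
    calc (1 / (10 : ℝ) ^ 4)⁻¹ = 10 ^ 4 := by norm_num
      _ ≤ X := hX4
  have hj : formJ (principalForm D) = ModularForm.E₄ τ ^ 3 / ModularForm.discriminant τ := by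
    rw [formJ_eq_kleinJ]; rfl
  have hcusp := norm_E₄_cube_div_discriminant_sub_sub_le τ hq4
  rw [← hq, ← hj] at hcusp
  have hqinv : ‖q⁻¹‖ = X := by rw [norm_inv, hnq, inv_inv]
  have h40 : 400000 * ‖q‖ ≤ 40 := by
    calc 400000 * ‖q‖ ≤ 400000 * (1 / 10 ^ 4) := by gcongr
      _ = 40 := by norm_num
  have htri : ‖q⁻¹‖ ≤ ‖formJ (principalForm D)‖ + ‖formJ (principalForm D) - q⁻¹ - 744‖ + 744 := by
    have e : q⁻¹ = formJ (principalForm D) - (formJ (principalForm D) - q⁻¹ - 744) - 744 := by ring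
    calc ‖q⁻¹‖ = ‖formJ (principalForm D) - (formJ (principalForm D) - q⁻¹ - 744) - 744‖ := by rw [← e]
      _ ≤ ‖formJ (principalForm D) - (formJ (principalForm D) - q⁻¹ - 744)‖ + ‖(744 : ℂ)‖ := norm_sub_le _ _
      _ ≤ ‖formJ (principalForm D)‖ + ‖formJ (principalForm D) - q⁻¹ - 744‖ + ‖(744 : ℂ)‖ := by
          gcongr; exact norm_sub_le _ _
      _ = _ := by norm_num
  rw [hqinv] at htri
  linarith

/-! ### Reduced forms inject into the class group: `h(d_K) ≤ h_K` -/

section ClassNumber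

variable {K : Type*} [Field K] [NumberField K]

/-- **`h(d_K) ≤ h_K`.** For an imaginary quadratic field `K` the number of reduced primitive positive
definite forms of discriminant `d_K` is at most the class number of `K`: with an integral basis
`(1, ω)`, `ω² = m + tω`, `d_K = t² + 4m`, the map `(A, B, C) ↦ [(A, ω − (B+t)/2)] ∈ Cl(K)` is
injective on reduced forms — equal classes give `Γ₀(1)`-equivalent Heegner points (the tree's
`isGamma0Equiv_of_span_mul_formIdeal_eq`), both in the strict fundamental domain, hence equal
(`inStrictFd_heegnerTau`, `smul_eq_self_of_inStrictFd`), and `τ_Q` determines `Q`.  This is the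
injectivity half of Cox, Thm. 7.7(ii) (`C(d_K) ≅ C(𝒪_K)`). [cite: Cox2013, §7.B Thm. 7.7(ii)] -/
theorem card_reducedForms_discr_le_classNumber (hK : IsImaginaryQuadratic K) :
    (reducedForms (discr K)).card ≤ classNumber K := by
  classical
  obtain ⟨b, hb⟩ := exists_basis_zero_eq_one (K := K) hK.1
  set m : ℤ := b.repr (b 1 * b 1) 0 with hm
  set t : ℤ := b.repr (b 1 * b 1) 1 with ht
  have hω : b 1 * b 1 = (m : 𝓞 K) + (t : 𝓞 K) * b 1 := basis_one_mul_self_eq b hb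
  have hDK : discr K = t ^ 2 + 4 * m := discr_eq_sq_add_four_mul b hb
  have hneg : t ^ 2 + 4 * m < 0 := hDK ▸ hK.discr_neg
  set D := discr K with hDdef
  have hD : D < 0 := hK.discr_neg
  -- the ideal of a form
  let I : ℤ × ℤ × ℤ → Ideal (𝓞 K) := fun Q =>
    Ideal.span {(Q.1 : 𝓞 K), b 1 - (((Q.2.1 + t) / 2 : ℤ) : 𝓞 K)}
  have hI0 : ∀ Q : ℤ × ℤ × ℤ, 0 < Q.1 → I Q ≠ 0 := by
    intro Q hQ h0
    have hmem : (Q.1 : 𝓞 K) ∈ I Q := Ideal.subset_span (by simp)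
    rw [h0] at hmem
    have h1 : (Q.1 : 𝓞 K) = 0 := by simpa using hmem
    have h2 : (Q.1 : ℤ) = 0 := by exact_mod_cast h1
    omega
  let f : ℤ × ℤ × ℤ → ClassGroup (𝓞 K) := fun Q =>
    if h : 0 < Q.1 then ClassGroup.mk0 ⟨I Q, mem_nonZeroDivisors_of_ne_zero (hI0 Q h)⟩ else 1
  have hmem : ∀ Q ∈ reducedForms D, Q ∈ heegnerForms 1 (t ^ 2 + 4 * m) ∧ 0 < Q.1 := by
    intro Q hQ
    obtain ⟨hdisc, hpos, hprim, -⟩ := (mem_reducedForms_iff hD).1 hQ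
    refine ⟨⟨?_, hpos, one_dvd _, ?_⟩, hpos⟩
    · rw [← hDK]; exact hdisc
    · exact (BinQF.isPrimitive_iff (f := ⟨Q.1, Q.2.1, Q.2.2⟩)).1 ((isPrimitive_iff_binQF Q).1 hprim)
  -- injectivity on reduced forms
  have hinj : Set.InjOn f (reducedForms D : Set (ℤ × ℤ × ℤ)) := by
    intro Q hQ Q' hQ' hQQ'
    rw [Finset.mem_coe] at hQ hQ'
    obtain ⟨hQh, hQpos⟩ := hmem Q hQ
    obtain ⟨hQ'h, hQ'pos⟩ := hmem Q' hQ'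
    simp only [f, dif_pos hQpos, dif_pos hQ'pos] at hQQ'
    obtain ⟨x, y, hx, hy, hxy⟩ := ClassGroup.mk0_eq_mk0_iff.1 hQQ'
    have hBB' : Q.2.1 ≡ Q'.2.1 [ZMOD 2 * (1 : ℕ)] := by
      obtain ⟨hdisc, -, -, -⟩ := (mem_reducedForms_iff hD).1 hQ
      obtain ⟨hdisc', -, -, -⟩ := (mem_reducedForms_iff hD).1 hQ'
      rw [Literature.NumberTheory.QuadraticFields.BinaryQuadraticForm.discr] at hdisc hdisc'
      have e : Q.2.1 ^ 2 - Q'.2.1 ^ 2 = 4 * (Q.1 * Q.2.2 - Q'.1 * Q'.2.2) := by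
        linear_combination hdisc - hdisc'
      rw [Int.ModEq, Nat.cast_one, mul_one]
      have h2 : (2 : ℤ) ∣ (Q.2.1 - Q'.2.1) * (Q.2.1 + Q'.2.1) := by
        rw [show (Q.2.1 - Q'.2.1) * (Q.2.1 + Q'.2.1) = Q.2.1 ^ 2 - Q'.2.1 ^ 2 by ring, e]
        exact Dvd.dvd.mul_right (by norm_num) _
      rcases (Int.prime_two.dvd_or_dvd h2) with h | h <;> omega
    have hequiv : IsGamma0Equiv 1 Q Q' :=
      isGamma0Equiv_of_span_mul_formIdeal_eq b hb hω hneg hQh hQ'h hBB' hx hxy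
    obtain ⟨γ, hγ⟩ := hequiv
    rw [Subgroup.smul_def] at hγ
    have hz := inStrictFd_heegnerTau hD hQ
    have hw := inStrictFd_heegnerTau hD hQ'
    rw [← hγ] at hw
    have heq : heegnerTau Q' = heegnerTau Q := by rw [← hγ]; exact smul_eq_self_of_inStrictFd hz hw
    obtain ⟨hd, h1, -, -⟩ := (mem_reducedForms_iff hD).1 hQ
    obtain ⟨hd', h1', -, -⟩ := (mem_reducedForms_iff hD).1 hQ'
    exact (eq_of_heegnerTau_eq h1 h1' (hd ▸ hD) (hd'.trans hd.symm) heq).symm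
  calc (reducedForms D).card ≤ (Finset.univ : Finset (ClassGroup (𝓞 K))).card :=
        Finset.card_le_card_of_injOn f (fun _ _ => Finset.mem_univ _) hinj
    _ = classNumber K := by rw [Finset.card_univ]; rfl

end ClassNumber

/-! ### The final asymptotics -/

/-- **"Comparing this with (6) implies Theorem 1"** (Granville–Stark, p. 5), as a statement about
real numbers: if `κ > 0` and `κ (π/3 − δ) < π`, there is `d₀ > 0` such that for every `d ≥ d₀` one has
`κ log d + A > 0`, `log d > 0`, and every `h > 0` with `π √d − L ≤ h (κ log d + A)` satisfies
`(π/3 − δ) √d / log d ≤ h`.  (With `θ = π/3 − δ` and `η = π − κθ > 0`: for `log d ≥ 2|θ||A|/η` and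
`√d ≥ 2|L|/η` one has `θ√d (κ log d + A) ≤ (π√d − L) log d`.)
[cite: GranvilleStark2000, §2 proof of Theorem 1] -/
theorem granvilleStark_asymptotics {δ κ A L : ℝ} (hκ0 : 0 < κ) (hmargin : κ * (π / 3 - δ) < π) :
    ∃ d₀ : ℝ, 0 < d₀ ∧ ∀ d : ℝ, d₀ ≤ d → 0 < κ * Real.log d + A ∧ 0 < Real.log d ∧
      ∀ h : ℝ, 0 < h → π * √d - L ≤ h * (κ * Real.log d + A) → (π / 3 - δ) * √d / Real.log d ≤ h := by
  set θ := π / 3 - δ with hθ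
  set η := π - κ * θ with hη
  have hη0 : 0 < η := by rw [hη]; linarith
  set B₁ : ℝ := 2 * |θ| * |A| / η with hB₁
  set B₂ : ℝ := (1 + |A|) / κ with hB₂
  set E₁ : ℝ := Real.exp (max 1 (max B₁ B₂)) with hE₁
  set E₂ : ℝ := (2 * |L| / η) ^ 2 with hE₂
  refine ⟨max E₁ E₂, lt_max_of_lt_left (Real.exp_pos _), fun d hd => ?_⟩
  have hdpos : 0 < d := lt_of_lt_of_le (lt_max_of_lt_left (Real.exp_pos _)) hd
  have hlog : max 1 (max B₁ B₂) ≤ Real.log d := by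
    rw [← Real.log_exp (max 1 (max B₁ B₂))]
    exact Real.log_le_log (Real.exp_pos _) ((le_max_left _ _).trans hd)
  have hlog1 : 1 ≤ Real.log d := (le_max_left _ _).trans hlog
  have hlogB₁ : B₁ ≤ Real.log d := ((le_max_left _ _).trans (le_max_right _ _)).trans hlog
  have hlogB₂ : B₂ ≤ Real.log d := ((le_max_right _ _).trans (le_max_right _ _)).trans hlog
  have hsqrt : 2 * |L| / η ≤ √d := by
    rw [← Real.sqrt_sq (by positivity : (0 : ℝ) ≤ 2 * |L| / η)]
    exact Real.sqrt_le_sqrt ((le_max_right _ _).trans hd)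
  have hden : 1 ≤ κ * Real.log d + A := by
    have : κ * B₂ = 1 + |A| := by rw [hB₂]; field_simp
    nlinarith [le_abs_self A, neg_abs_le A, mul_le_mul_of_nonneg_left hlogB₂ hκ0.le]
  refine ⟨by linarith, by linarith, fun h hh hmain => ?_⟩
  have hsd : 0 ≤ √d := Real.sqrt_nonneg d
  have hkey : θ * √d * (κ * Real.log d + A) ≤ (π * √d - L) * Real.log d := by
    have h1 : θ * A * √d ≤ η / 2 * √d * Real.log d := by
      have hB : 2 * |θ| * |A| ≤ η * Real.log d := by
        have := mul_le_mul_of_nonneg_left hlogB₁ hη0.le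
        rw [hB₁, mul_div_cancel₀ _ hη0.ne'] at this
        exact this
      have hθA : θ * A ≤ |θ| * |A| := by
        rw [← abs_mul]; exact le_abs_self _
      nlinarith
    have h2 : L * Real.log d ≤ η / 2 * √d * Real.log d := by
      have hL : 2 * |L| ≤ η * √d := by
        have := mul_le_mul_of_nonneg_left hsqrt hη0.le
        rw [mul_div_cancel₀ _ hη0.ne'] at this
        exact this
      have hlog0 : 0 ≤ Real.log d := by linarith
      nlinarith [le_abs_self L, mul_le_mul_of_nonneg_right hL hlog0]
    have e : (π * √d - L) * Real.log d - θ * √d * (κ * Real.log d + A) =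
        η * √d * Real.log d - (θ * A * √d + L * Real.log d) := by rw [hη]; ring
    nlinarith
  have hdenpos : 0 < κ * Real.log d + A := by linarith
  have hlogpos : 0 < Real.log d := by linarith
  calc θ * √d / Real.log d ≤ (π * √d - L) / (κ * Real.log d + A) := by
        rw [div_le_div_iff₀ hlogpos hdenpos]; exact hkey
    _ ≤ h := by rw [div_le_iff₀ hdenpos]; exact hmain

end Literature.NumberTheory.DiophantineGeometry

end
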